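import Mathlib
import HarnessLib
import Summits.Ventures.LatticeQCDFlow.Scaling.AutoregressiveGaugeMixingProfile
import Summits.Ventures.LatticeQCDFlow.Exactness.IMHMixingWindow

/-!
# LatticeQCDFlow / Scaling — the mixing-time window of the two exact gauge samplers:
# `ε`-mixed once `t·A(cold) ≥ log(1/ε)`, not `ε`-mixed while `t·A(cold) < 1 − ε`

HONEST FRAMING: exact (Metropolis-corrected) sampling algorithms for lattice gauge theory;
figures of merit are autocorrelation/cost numbers at stated couplings and volumes; no
continuum-physics claim.

Venture `LatticeQCDFlow` (cell pub-lqcd), topic `Scaling`, FANOUT row 30 (lean-1, GEN-28) — OUR WORK on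
THEORY-2.md §4 row C5.  `AutoregressiveGaugeMixingProfile` identified the exact worst-case total-variation profile
`(1 − A(cold))^t` of the one-plaquette heat bath (`A(cold) = Z/(c^{#B} M^k)`) and of the all-closing conditioner
(`A(cold) = Z/∏_{ℓ∈T} c_{#C_ℓ}`).  Two elementary inequalities (`1 − A ≤ e^{−A}` and Bernoulli's
`1 − tA ≤ (1 − A)^t`) turn the profile into a two-sided window for the `ε`-mixing time WITHOUT logarithms of the
profile itself (the two real inequalities are `Exactness/IMHMixingWindow`'s `one_sub_pow_le_of_log_le`,
`lt_one_sub_pow_of_mul_lt`, where the abstract independence-sampler window is proved):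

* **`heatBath_mixed_of_log_le`** — if `t · Z/(c^{#B} M^k) ≥ log(1/ε)` (`ε > 0`) then at time `t` every start and
  event of the heat bath are `ε`-close to `π`;
* **`heatBath_not_mixed_of_mul_lt`** — (atom-free Haar, `d ≥ 1`) if `t · Z/(c^{#B} M^k) < 1 − ε` then they
  are not: some start and event deviate by more than `ε`;
* **`allClosing_mixed_of_log_le`**, **`allClosing_not_mixed_of_mul_lt`** — the same for the all-closing
  conditioner with `Z/∏_{ℓ∈T} c_{#C_ℓ}`.

So the worst-case `ε`-mixing time of either sampler lies in the window `[(1 − ε)/A(cold), log(1/ε)/A(cold) + 1]`: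
it IS the inverse cold acceptance mass up to the factor between `1 − ε` and `log(1/ε)`.
NOT CLAIMED: the size of `Z`, or mixing from a particular warm start.
No `def`, no `sorry`, nothing cited as a fact beyond the tree.
-/

noncomputable section

namespace Summit.Ventures.LatticeQCDFlow.Theory2.Autoregressive

open MeasureTheory ProbabilityTheory Function Finset Summit.Ventures.LatticeQCDFlow.Exactness
open Literature.MathematicalPhysics.QuantumFieldTheory Literature.MathematicalPhysics.QuantumLattice
open scoped ENNReal

variable {d L : ℕ} [NeZero L] {G : Type*} [Group G] [TopologicalSpace G] [IsTopologicalGroup G]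
  [CompactSpace G] [SecondCountableTopology G] [MeasurableSpace G] [BorelSpace G]

/-- **HEAT BATH, UPPER WINDOW EDGE**: if `t · Z/(c^{#B} M^k) ≥ log(1/ε)` (`ε > 0`), then at time `t` every start
and every event are `ε`-close to `π`. [ours] -/
theorem heatBath_mixed_of_log_le (hL : 2 ≤ L) {w : G → ℝ} (hw : Continuous w) {m M : ℝ} (hm0 : 0 < m)
    (hm : ∀ g, m ≤ w g) (hM : ∀ g, w g ≤ M) (hw1 : w 1 = M)
    (B : Finset (Plaquette d L)) (t : Plaquette d L → Edge d L)
    (ht : ∀ p ∈ B, t p ∈ ({(p.1, p.2.1.1), (p.1.shift p.2.1.1, p.2.1.2),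
        (p.1.shift p.2.1.2, p.2.1.1), (p.1, p.2.1.2)} : Finset (Edge d L)))
    (rank : Plaquette d L → ℕ)
    (hrank : ∀ p ∈ B, ∀ p' ∈ B, p ≠ p' → t p ∈ ({(p'.1, p'.2.1.1), (p'.1.shift p'.2.1.1, p'.2.1.2),
        (p'.1.shift p'.2.1.2, p'.2.1.1), (p'.1, p'.2.1.2)} : Finset (Edge d L)) → rank p < rank p')
    (π q : Measure (GaugeConfig d L G)) [IsProbabilityMeasure π] [IsProbabilityMeasure q]
    (hπ : π = (Measure.pi fun _ : Edge d L => haarProbability G).withDensity fun U =>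
      ENNReal.ofReal ((∏ p : Plaquette d L, w (plaquetteHolonomy U p.1 p.2.1.1 p.2.1.2)) /
        ∫ V, ∏ p : Plaquette d L, w (plaquetteHolonomy V p.1 p.2.1.1 p.2.1.2)
          ∂(Measure.pi fun _ : Edge d L => haarProbability G)))
    (hq : q = (Measure.pi fun _ : Edge d L => haarProbability G).withDensity fun U =>
      ENNReal.ofReal ((∏ p ∈ B, w (plaquetteHolonomy U p.1 p.2.1.1 p.2.1.2)) /
        ∫ V, ∏ p ∈ B, w (plaquetteHolonomy V p.1 p.2.1.1 p.2.1.2)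
          ∂(Measure.pi fun _ : Edge d L => haarProbability G)))
    {ε : ℝ} (hε : 0 < ε) {n : ℕ}
    (hn : Real.log (1 / ε) ≤ n * ((∫ V, ∏ p : Plaquette d L, w (plaquetteHolonomy V p.1 p.2.1.1 p.2.1.2)
          ∂(Measure.pi fun _ : Edge d L => haarProbability G)) /
        ((∫ g, w g ∂(haarProbability G)) ^ B.card * M ^ (Finset.univ \ B).card)))
    (μ : Measure (GaugeConfig d L G)) [IsProbabilityMeasure μ] (A : Set (GaugeConfig d L G)) :
    |((fun ν : Measure (GaugeConfig d L G) => ν.bind (indepMH q fun U =>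
        ((∫ V, ∏ p : Plaquette d L, w (plaquetteHolonomy V p.1 p.2.1.1 p.2.1.2)
            ∂(Measure.pi fun _ : Edge d L => haarProbability G)) /
          ((∫ V, ∏ p ∈ B, w (plaquetteHolonomy V p.1 p.2.1.1 p.2.1.2)
            ∂(Measure.pi fun _ : Edge d L => haarProbability G)) *
            ∏ p ∈ Finset.univ \ B, w (plaquetteHolonomy U p.1 p.2.1.1 p.2.1.2)))⁻¹))^[n] μ).real A -
        π.real A| ≤ ε := by
  have hb := heatBath_uniform_rate hL hw hm0 hm hM hw1 B t ht rank hrank π q hπ hq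
  have h1 := hb π 1 Set.univ
  rw [pow_one] at h1
  have hA := (abs_nonneg _).trans h1
  exact (hb μ n A).trans (one_sub_pow_le_of_log_le hε (by linarith) hn)

/-- **HEAT BATH, LOWER WINDOW EDGE** (atom-free Haar, `d ≥ 1`): if `t · Z/(c^{#B} M^k) < 1 − ε`, then at time `t`
NOT every start and event are `ε`-close to `π` (the cold start on `{cold}` deviates by more than `ε`). [ours] -/
theorem heatBath_not_mixed_of_mul_lt [MeasurableSingletonClass G] [NullSingletonClass (haarProbability G)]
    (hd : 0 < d) (hL : 2 ≤ L) {w : G → ℝ} (hw : Continuous w) {m M : ℝ} (hm0 : 0 < m)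
    (hm : ∀ g, m ≤ w g) (hM : ∀ g, w g ≤ M) (hw1 : w 1 = M)
    (B : Finset (Plaquette d L)) (t : Plaquette d L → Edge d L)
    (ht : ∀ p ∈ B, t p ∈ ({(p.1, p.2.1.1), (p.1.shift p.2.1.1, p.2.1.2),
        (p.1.shift p.2.1.2, p.2.1.1), (p.1, p.2.1.2)} : Finset (Edge d L)))
    (rank : Plaquette d L → ℕ)
    (hrank : ∀ p ∈ B, ∀ p' ∈ B, p ≠ p' → t p ∈ ({(p'.1, p'.2.1.1), (p'.1.shift p'.2.1.1, p'.2.1.2),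
        (p'.1.shift p'.2.1.2, p'.2.1.1), (p'.1, p'.2.1.2)} : Finset (Edge d L)) → rank p < rank p')
    (π q : Measure (GaugeConfig d L G)) [IsProbabilityMeasure π] [IsProbabilityMeasure q]
    (hπ : π = (Measure.pi fun _ : Edge d L => haarProbability G).withDensity fun U =>
      ENNReal.ofReal ((∏ p : Plaquette d L, w (plaquetteHolonomy U p.1 p.2.1.1 p.2.1.2)) /
        ∫ V, ∏ p : Plaquette d L, w (plaquetteHolonomy V p.1 p.2.1.1 p.2.1.2)
          ∂(Measure.pi fun _ : Edge d L => haarProbability G)))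
    (hq : q = (Measure.pi fun _ : Edge d L => haarProbability G).withDensity fun U =>
      ENNReal.ofReal ((∏ p ∈ B, w (plaquetteHolonomy U p.1 p.2.1.1 p.2.1.2)) /
        ∫ V, ∏ p ∈ B, w (plaquetteHolonomy V p.1 p.2.1.1 p.2.1.2)
          ∂(Measure.pi fun _ : Edge d L => haarProbability G)))
    {ε : ℝ} {n : ℕ}
    (hn : n * ((∫ V, ∏ p : Plaquette d L, w (plaquetteHolonomy V p.1 p.2.1.1 p.2.1.2)
          ∂(Measure.pi fun _ : Edge d L => haarProbability G)) /
        ((∫ g, w g ∂(haarProbability G)) ^ B.card * M ^ (Finset.univ \ B).card)) < 1 - ε) :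
    ¬ ∀ (μ : Measure (GaugeConfig d L G)) [IsProbabilityMeasure μ] (A : Set (GaugeConfig d L G)),
      |((fun ν : Measure (GaugeConfig d L G) => ν.bind (indepMH q fun U =>
        ((∫ V, ∏ p : Plaquette d L, w (plaquetteHolonomy V p.1 p.2.1.1 p.2.1.2)
            ∂(Measure.pi fun _ : Edge d L => haarProbability G)) /
          ((∫ V, ∏ p ∈ B, w (plaquetteHolonomy V p.1 p.2.1.1 p.2.1.2)
            ∂(Measure.pi fun _ : Edge d L => haarProbability G)) *
            ∏ p ∈ Finset.univ \ B, w (plaquetteHolonomy U p.1 p.2.1.1 p.2.1.2)))⁻¹))^[n] μ).real A -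
        π.real A| ≤ ε := by
  intro h
  have h1 := (heatBath_worstCase_le_iff hd hL hw hm0 hm hM hw1 B t ht rank hrank π q hπ hq n ε).1 h
  have hb := heatBath_uniform_rate hL hw hm0 hm hM hw1 B t ht rank hrank π q hπ hq π 1 Set.univ
  rw [pow_one] at hb
  have hA := (abs_nonneg _).trans hb
  exact absurd h1 (not_le.2 (lt_one_sub_pow_of_mul_lt (by linarith) hn))

/-- **ALL-CLOSING CONDITIONER, UPPER WINDOW EDGE**: if `t · Z/∏_{ℓ∈T} c_{#C_ℓ} ≥ log(1/ε)` (`ε > 0`), then at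
time `t` every start and every event are `ε`-close to `π`. [ours] -/
theorem allClosing_mixed_of_log_le (hL : 2 ≤ L) {w : G → ℝ} (hw : Continuous w) {m M : ℝ} (hm0 : 0 < m)
    (hm : ∀ g, m ≤ w g) (hM : ∀ g, w g ≤ M) (hwinv : ∀ g, w g⁻¹ = w g)
    (T : Finset (Edge d L)) (C : Edge d L → Finset (Plaquette d L))
    (hCne : ∀ ℓ ∈ T, (C ℓ).Nonempty)
    (hCe : ∀ ℓ ∈ T, ∀ p ∈ C ℓ, ℓ ∈ ({(p.1, p.2.1.1), (p.1.shift p.2.1.1, p.2.1.2),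
        (p.1.shift p.2.1.2, p.2.1.1), (p.1, p.2.1.2)} : Finset (Edge d L)))
    (hdisj : ∀ ℓ ∈ T, ∀ ℓ' ∈ T, ℓ ≠ ℓ' → Disjoint (C ℓ) (C ℓ'))
    (hcover : ∀ p : Plaquette d L, ∃ ℓ ∈ T, p ∈ C ℓ)
    (π q : Measure (GaugeConfig d L G)) [IsProbabilityMeasure π] [IsProbabilityMeasure q]
    (hπ : π = (Measure.pi fun _ : Edge d L => haarProbability G).withDensity fun U =>
      ENNReal.ofReal ((∏ p : Plaquette d L, w (plaquetteHolonomy U p.1 p.2.1.1 p.2.1.2)) /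
        ∫ V, ∏ p : Plaquette d L, w (plaquetteHolonomy V p.1 p.2.1.1 p.2.1.2) ∂(Measure.pi fun _ : Edge d L => haarProbability G)))
    (hq : q = (Measure.pi fun _ : Edge d L => haarProbability G).withDensity fun U =>
      ENNReal.ofReal (∏ ℓ ∈ T, (∏ p ∈ C ℓ, w (plaquetteHolonomy U p.1 p.2.1.1 p.2.1.2)) /
          (∫ v, ∏ p ∈ C ℓ, w (plaquetteHolonomy (update U ℓ v) p.1 p.2.1.1 p.2.1.2) ∂(haarProbability G))))
    {ε : ℝ} (hε : 0 < ε) {n : ℕ}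
    (hn : Real.log (1 / ε) ≤ n * ((∫ V, ∏ p : Plaquette d L, w (plaquetteHolonomy V p.1 p.2.1.1 p.2.1.2)
          ∂(Measure.pi fun _ : Edge d L => haarProbability G)) /
        ∏ ℓ ∈ T, ∫ h, w h ^ (C ℓ).card ∂(haarProbability G)))
    (μ : Measure (GaugeConfig d L G)) [IsProbabilityMeasure μ] (A : Set (GaugeConfig d L G)) :
    |((fun ν : Measure (GaugeConfig d L G) => ν.bind (indepMH q fun U =>
        (((∫ V, ∏ p : Plaquette d L, w (plaquetteHolonomy V p.1 p.2.1.1 p.2.1.2) ∂(Measure.pi fun _ : Edge d L => haarProbability G)) /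
          ∏ ℓ ∈ T, (∫ v, ∏ p ∈ C ℓ, w (plaquetteHolonomy (update U ℓ v) p.1 p.2.1.1 p.2.1.2) ∂(haarProbability G))))⁻¹))^[n] μ).real A -
        π.real A| ≤ ε := by
  have hb := allClosing_uniform_rate hL hw hm0 hm hM hwinv T C hCne hCe hdisj hcover π q hπ hq
  have h1 := hb π 1 Set.univ
  rw [pow_one] at h1
  have hA := (abs_nonneg _).trans h1
  exact (hb μ n A).trans (one_sub_pow_le_of_log_le hε (by linarith) hn)

/-- **ALL-CLOSING CONDITIONER, LOWER WINDOW EDGE** (atom-free Haar, `d ≥ 1`): if `t · Z/∏_{ℓ∈T} c_{#C_ℓ} < 1 − ε`,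
then at time `t` NOT every start and event are `ε`-close to `π`. [ours] -/
theorem allClosing_not_mixed_of_mul_lt [MeasurableSingletonClass G] [NullSingletonClass (haarProbability G)]
    (hd : 0 < d) (hL : 2 ≤ L) {w : G → ℝ} (hw : Continuous w) {m M : ℝ} (hm0 : 0 < m)
    (hm : ∀ g, m ≤ w g) (hM : ∀ g, w g ≤ M) (hwinv : ∀ g, w g⁻¹ = w g)
    (T : Finset (Edge d L)) (C : Edge d L → Finset (Plaquette d L))
    (hCne : ∀ ℓ ∈ T, (C ℓ).Nonempty)
    (hCe : ∀ ℓ ∈ T, ∀ p ∈ C ℓ, ℓ ∈ ({(p.1, p.2.1.1), (p.1.shift p.2.1.1, p.2.1.2),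
        (p.1.shift p.2.1.2, p.2.1.1), (p.1, p.2.1.2)} : Finset (Edge d L)))
    (hdisj : ∀ ℓ ∈ T, ∀ ℓ' ∈ T, ℓ ≠ ℓ' → Disjoint (C ℓ) (C ℓ'))
    (hcover : ∀ p : Plaquette d L, ∃ ℓ ∈ T, p ∈ C ℓ)
    (π q : Measure (GaugeConfig d L G)) [IsProbabilityMeasure π] [IsProbabilityMeasure q]
    (hπ : π = (Measure.pi fun _ : Edge d L => haarProbability G).withDensity fun U =>
      ENNReal.ofReal ((∏ p : Plaquette d L, w (plaquetteHolonomy U p.1 p.2.1.1 p.2.1.2)) /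
        ∫ V, ∏ p : Plaquette d L, w (plaquetteHolonomy V p.1 p.2.1.1 p.2.1.2) ∂(Measure.pi fun _ : Edge d L => haarProbability G)))
    (hq : q = (Measure.pi fun _ : Edge d L => haarProbability G).withDensity fun U =>
      ENNReal.ofReal (∏ ℓ ∈ T, (∏ p ∈ C ℓ, w (plaquetteHolonomy U p.1 p.2.1.1 p.2.1.2)) /
          (∫ v, ∏ p ∈ C ℓ, w (plaquetteHolonomy (update U ℓ v) p.1 p.2.1.1 p.2.1.2) ∂(haarProbability G))))
    {ε : ℝ} {n : ℕ}
    (hn : n * ((∫ V, ∏ p : Plaquette d L, w (plaquetteHolonomy V p.1 p.2.1.1 p.2.1.2)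
          ∂(Measure.pi fun _ : Edge d L => haarProbability G)) /
        ∏ ℓ ∈ T, ∫ h, w h ^ (C ℓ).card ∂(haarProbability G)) < 1 - ε) :
    ¬ ∀ (μ : Measure (GaugeConfig d L G)) [IsProbabilityMeasure μ] (A : Set (GaugeConfig d L G)),
      |((fun ν : Measure (GaugeConfig d L G) => ν.bind (indepMH q fun U =>
        (((∫ V, ∏ p : Plaquette d L, w (plaquetteHolonomy V p.1 p.2.1.1 p.2.1.2) ∂(Measure.pi fun _ : Edge d L => haarProbability G)) /
          ∏ ℓ ∈ T, (∫ v, ∏ p ∈ C ℓ, w (plaquetteHolonomy (update U ℓ v) p.1 p.2.1.1 p.2.1.2) ∂(haarProbability G))))⁻¹))^[n] μ).real A -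
        π.real A| ≤ ε := by
  intro h
  have h1 := (allClosing_worstCase_le_iff hd hL hw hm0 hm hM hwinv T C hCne hCe hdisj hcover π q hπ hq n ε).1 h
  have hb := allClosing_uniform_rate hL hw hm0 hm hM hwinv T C hCne hCe hdisj hcover π q hπ hq π 1 Set.univ
  rw [pow_one] at hb
  have hA := (abs_nonneg _).trans hb
  exact absurd h1 (not_le.2 (lt_one_sub_pow_of_mul_lt (by linarith) hn))

end Summit.Ventures.LatticeQCDFlow.Theory2.Autoregressive

end
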